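import Literature.Geometry.Manifold.ProperSubmersionTrivial
import Mathlib.Geometry.Manifold.Diffeomorph
import HarnessLib

/-!
# A proper submersion onto `ℝᵐ` is smoothly trivial: the Ehresmann trivialisation is a diffeomorphism

General differential topology; theorems-only companion of
`Literature/Geometry/Manifold/ProperSubmersionTrivial` (Bröcker–Jänich 1982, (8.12), PDF pp. 57–58:
"there exists a neighbourhood `U` of `p` in `M` and a DIFFEOMORPHISM `φ : U × F → f⁻¹U`" with
`f ∘ φ = pr₁`), which records the trivialisation of a proper submersion `g : N → ℝᵐ` by the folds of
the flows of lifted basic fields only as a HOMEOMORPHISM `ℝᵐ × g⁻¹(0) ≃ₜ N` ("the trivialisation is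
by flows of the lifted basic fields and is in fact smooth; only the homeomorphism is recorded").
Here the smoothness is recorded, in the chart-free form consumed by deformation theory (K. Kodaira,
*Complex Manifolds and Deformation of Complex Structures* (2005), Thm. 2.3 = Thm. 2.5: the fibres
of a differentiable family are diffeomorphic, through a `C^∞` family of diffeomorphisms of the total
space carrying fibre to fibre; C. Voisin, *Hodge Theory I*, Thm. 9.3 and Prop. 9.5):

* `contMDiff_foldr_flow`, `contMDiff_foldl_flow` — joint smoothness of the folds of jointly smooth
  flows with smoothly varying times (the smooth analogues of `continuous_foldr_flow`,
  `continuous_foldl_flow`);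
* `exists_contMDiff_trivialisation_of_surjective_mfderiv` — **smooth Ehresmann over `ℝᵐ`**: for a
  `C^∞` map `g : N → ℝᵐ` with onto differential and compact preimages of closed balls on a Hausdorff
  second-countable `C^∞` manifold without boundary, there are JOINTLY `C^∞` maps
  `T, S : ℝᵐ × N → N`, inverse to each other for each fixed `u` (`S (u, T (u, y)) = y`,
  `T (u, S (u, y)) = y`), with `T (0, ·) = id` and `g (T (u, y)) = g y + u` — the flows of the lifted
  basic fields are smooth global flows (`exists_globalFlow_of_lift`, itself from
  `exists_contMDiff_globalFlow_of_complete`), and `T`, `S` are their right/left folds;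
* `exists_diffeomorph_apply_eq_add` — hence for every `u ∈ ℝᵐ` a diffeomorphism `Φ_u : N ≃ₘ N`
  with `g ∘ Φ_u = g + u`, carrying each fibre `g⁻¹(v)` onto `g⁻¹(v + u)`
  (`image_preimage_singleton_eq`): **all fibres of a proper submersion onto `ℝᵐ` are diffeomorphic
  through ambient diffeomorphisms depending smoothly on the parameter** (Kodaira Thm. 2.3/2.5 for
  the base `ℝᵐ`; the general base is reached chart by chart exactly as in the tree's
  `ehresmann_fibration_holds`).

Everything is proved; no definitions, no named facts. (Written as the `C^∞`-Ehresmann input of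
Kodaira's semicontinuity theorem for the Hodge numbers, Kodaira (2005) §7, cf.
`Literature/Analysis/OperatorTheory/NullityUpperSemicontinuous`.)

## References

* Th. Bröcker, K. Jänich, *Introduction to Differential Topology*, CUP 1982, (8.12) and its proof.
  [BrockerJanichIDT1982]
* K. Kodaira, *Complex Manifolds and Deformation of Complex Structures*, Springer Classics (2005),
  §2.3 Thms. 2.3, 2.5; §7.2. [Kodaira2005]
* C. Voisin, *Hodge Theory and Complex Algebraic Geometry I* (2002), Thm. 9.3, Prop. 9.5. [VoisinHodgeI2002]
-/

open scoped Manifold ContDiff Topology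
open Set Function Filter Metric

noncomputable section

namespace Literature.Geometry.Manifold

universe u v w

/-! ### Smooth folds of smooth flows -/

section SmoothFolds

variable {EN : Type u} [NormedAddCommGroup EN] [NormedSpace ℝ EN]
  {H : Type v} [TopologicalSpace H] {I : ModelWithCorners ℝ EN H}
  {N : Type w} [TopologicalSpace N] [ChartedSpace H N]
  {EP : Type*} [NormedAddCommGroup EP] [NormedSpace ℝ EP]
  {HP : Type*} [TopologicalSpace HP] {IP : ModelWithCorners ℝ EP HP}
  {P : Type*} [TopologicalSpace P] [ChartedSpace HP P]
  {ι : Type*} {θ : ι → ℝ × N → N}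

/-- Joint smoothness of the right fold `(p, y) ↦ θ_{i_1}(a_{i_1}(p), … θ_{i_k}(a_{i_k}(p), y)…)` of
jointly `C^∞` flows `θ_i : ℝ × N → N` with `C^∞` time functions `a_i : P → ℝ`. [folklore] -/
theorem contMDiff_foldr_flow (hθ : ∀ i, ContMDiff (𝓘(ℝ, ℝ).prod I) I ∞ (θ i)) {a : ι → P → ℝ}
    (ha : ∀ i, ContMDiff IP 𝓘(ℝ, ℝ) ∞ (a i)) (l : List ι) :
    ContMDiff (IP.prod I) I ∞ fun p : P × N => l.foldr (fun i acc => θ i (a i p.1, acc)) p.2 := by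
  induction l with
  | nil => simpa using contMDiff_snd
  | cons i l ih =>
    simp only [List.foldr_cons]
    exact (hθ i).comp (((ha i).comp contMDiff_fst).prodMk ih)

/-- Joint smoothness of the left fold of jointly `C^∞` flows with `C^∞` time functions. [folklore] -/
theorem contMDiff_foldl_flow (hθ : ∀ i, ContMDiff (𝓘(ℝ, ℝ).prod I) I ∞ (θ i)) {a : ι → P → ℝ}
    (ha : ∀ i, ContMDiff IP 𝓘(ℝ, ℝ) ∞ (a i)) (l : List ι) :
    ContMDiff (IP.prod I) I ∞ fun p : P × N => l.foldl (fun acc i => θ i (a i p.1, acc)) p.2 := by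
  induction l with
  | nil => simpa using contMDiff_snd
  | cons i l ih =>
    simp only [List.foldl_cons]
    exact ih.comp (contMDiff_fst.prodMk ((hθ i).comp (((ha i).comp contMDiff_fst).prodMk
      contMDiff_snd)))

end SmoothFolds

/-! ### Translating maps carry fibre to fibre -/

section Fibres

variable {N : Type w} {m : ℕ} {g : N → EuclideanSpace ℝ (Fin m)}

/-- A bijection `Φ` of `N` translating `g : N → ℝᵐ` by `u` (`g ∘ Φ = g + u`, as the diffeomorphisms
of `exists_diffeomorph_apply_eq_add` below) carries the fibre `g⁻¹(v)` ONTO the fibre `g⁻¹(v + u)`. [cite: Kodaira2005, §2.3 Thm. 2.5] -/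
theorem image_preimage_singleton_eq_of_apply_eq_add {Φ : N ≃ N} {u : EuclideanSpace ℝ (Fin m)}
    (hΦ : ∀ y, g (Φ y) = g y + u) (v : EuclideanSpace ℝ (Fin m)) :
    Φ '' (g ⁻¹' {v}) = g ⁻¹' {v + u} := by
  ext z
  simp only [mem_image, mem_preimage, mem_singleton_iff]
  constructor
  · rintro ⟨y, hy, rfl⟩
    rw [hΦ, hy]
  · intro hz
    refine ⟨Φ.symm z, ?_, Φ.apply_symm_apply z⟩
    have h := hΦ (Φ.symm z)
    rw [Φ.apply_symm_apply, hz] at h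
    exact add_right_cancel h.symm

end Fibres

/-! ### The smooth trivialisation -/

section Core

variable {EN : Type u} [NormedAddCommGroup EN] [NormedSpace ℝ EN] [FiniteDimensional ℝ EN]
  {H : Type v} [TopologicalSpace H] {I : ModelWithCorners ℝ EN H} [I.Boundaryless]
  {N : Type w} [TopologicalSpace N] [ChartedSpace H N] [IsManifold I ∞ N] [T2Space N]
  [SecondCountableTopology N] {m : ℕ} {g : N → EuclideanSpace ℝ (Fin m)}

/-- **Smooth Ehresmann over `ℝᵐ`** (Bröcker–Jänich 1982, (8.12) and its proof: "a
diffeomorphism `φ : U × F → f⁻¹U` … `φ(u, x) = Φ¹_{u_1} ∘ … ∘ Φⁿ_{u_n}(x)`", inverse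
"`φ⁻¹(y) = (u, Φⁿ_{-u_n} ∘ … ∘ Φ¹_{-u_1}(y))`"). Let `N` be a Hausdorff second-countable `C^∞`
manifold without boundary over a finite-dimensional real model and `g : N → ℝᵐ` a `C^∞` map with
`mfderiv g x` onto for every `x` and compact preimages of closed balls. Then there are jointly
`C^∞` maps `T, S : ℝᵐ × N → N` with `S (u, T (u, y)) = y`, `T (u, S (u, y)) = y`, `T (0, y) = y` and
`g (T (u, y)) = g y + u`: `T (u, ·)` is a diffeomorphism of `N` translating `g` by `u`, depending
smoothly on `u`, and `(u, x) ↦ T (u, x)` restricted to `ℝᵐ × g⁻¹(0)` is the (smooth) trivialisation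
of `exists_homeomorph_fibre_prod_of_surjective_mfderiv`. Proof: the lifted basic fields
(`exists_contMDiff_lift_of_surjective_mfderiv`) have smooth global flows translating `g`
(`exists_globalFlow_of_lift`); fold them (`contMDiff_foldr_flow`, `foldl_foldr_flow`,
`apply_foldr_flow`). [cite: BrockerJanichIDT1982, (8.12)] -/
theorem exists_contMDiff_trivialisation_of_surjective_mfderiv
    (hg : ContMDiff I 𝓘(ℝ, EuclideanSpace ℝ (Fin m)) ∞ g)
    (hsurj : ∀ x, Surjective (mfderiv I 𝓘(ℝ, EuclideanSpace ℝ (Fin m)) g x))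
    (hK : ∀ (u : EuclideanSpace ℝ (Fin m)) (R : ℝ), IsCompact (g ⁻¹' closedBall u R)) :
    ∃ T S : EuclideanSpace ℝ (Fin m) × N → N,
      ContMDiff (𝓘(ℝ, EuclideanSpace ℝ (Fin m)).prod I) I ∞ T ∧
      ContMDiff (𝓘(ℝ, EuclideanSpace ℝ (Fin m)).prod I) I ∞ S ∧
      (∀ u y, S (u, T (u, y)) = y) ∧ (∀ u y, T (u, S (u, y)) = y) ∧
      (∀ y, T (0, y) = y) ∧ ∀ u y, g (T (u, y)) = g y + u := by
  haveI : CompleteSpace EN := FiniteDimensional.complete ℝ EN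
  haveI : LocallyCompactSpace H := I.locallyCompactSpace
  haveI : LocallyCompactSpace N := ChartedSpace.locallyCompactSpace H N
  set e := EuclideanSpace.basisFun (Fin m) ℝ with he
  -- the smooth flows of the lifted basic fields
  have hflow : ∀ i : Fin m, ∃ θ : ℝ × N → N, ContMDiff (𝓘(ℝ, ℝ).prod I) I ∞ θ ∧
      (∀ p, θ (0, p) = p) ∧ (∀ t s p, θ (t, θ (s, p)) = θ (t + s, p)) ∧
      ∀ t p, g (θ (t, p)) = g p + t • e i := by
    intro i
    obtain ⟨X, hXs, hXc⟩ := exists_contMDiff_lift_of_surjective_mfderiv hg hsurj (e i)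
    obtain ⟨θ, hθs, hθ0, hθadd, -, hθg⟩ := exists_globalFlow_of_lift hg hXs hXc hK
    exact ⟨θ, hθs, hθ0, hθadd, hθg⟩
  choose θ hθs hθ0 hθadd hθg using hflow
  have hcoord : ∀ i : Fin m, ContMDiff 𝓘(ℝ, EuclideanSpace ℝ (Fin m)) 𝓘(ℝ, ℝ) ∞
      fun u : EuclideanSpace ℝ (Fin m) => u i := fun i =>
    (EuclideanSpace.proj i : EuclideanSpace ℝ (Fin m) →L[ℝ] ℝ).contMDiff
  refine ⟨fun p => (List.finRange m).foldr (fun i acc => θ i (p.1 i, acc)) p.2,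
    fun p => (List.finRange m).foldl (fun acc i => θ i (-(p.1 i), acc)) p.2,
    contMDiff_foldr_flow hθs hcoord _,
    contMDiff_foldl_flow hθs (fun i => (hcoord i).neg) _,
    fun u y => foldl_foldr_flow hθ0 hθadd (fun i => u i) (List.finRange m) y,
    fun u y => foldr_foldl_flow hθ0 hθadd (fun i => u i) (List.finRange m) y,
    fun y => ?_, fun u y => ?_⟩
  · -- `T (0, y) = y`: all times vanish
    have h : ∀ l : List (Fin m),
        l.foldr (fun i acc => θ i ((0 : EuclideanSpace ℝ (Fin m)) i, acc)) y = y := by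
      intro l
      induction l with
      | nil => rfl
      | cons i l ih =>
        rw [List.foldr_cons, ih]
        have h0 : ((0 : EuclideanSpace ℝ (Fin m)) i) = 0 := by simp
        rw [h0, hθ0]
    exact h _
  · -- `g (T (u, y)) = g y + Σ u_i e_i = g y + u`
    have h := apply_foldr_flow hθg (fun i => u i) (List.finRange m) y
    rw [← Fin.sum_univ_def (fun i => u i • e i)] at h
    have hu : ∑ i, u i • e i = u := by simpa [he] using e.sum_repr u
    rwa [hu] at h

/-- **The fibres of a proper submersion onto `ℝᵐ` are diffeomorphic through ambient diffeomorphisms**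
(Kodaira (2005), Thms. 2.3 and 2.5, for the base `ℝᵐ`; Bröcker–Jänich (8.12)): for every `u ∈ ℝᵐ`
there is a `C^∞` diffeomorphism `Φ` of `N` with `g (Φ y) = g y + u` for all `y` — the time-`u` map
of the smooth trivialisation. [cite: Kodaira2005, §2.3 Thm. 2.5] [cite: BrockerJanichIDT1982, (8.12)] -/
theorem exists_diffeomorph_apply_eq_add
    (hg : ContMDiff I 𝓘(ℝ, EuclideanSpace ℝ (Fin m)) ∞ g)
    (hsurj : ∀ x, Surjective (mfderiv I 𝓘(ℝ, EuclideanSpace ℝ (Fin m)) g x))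
    (hK : ∀ (u : EuclideanSpace ℝ (Fin m)) (R : ℝ), IsCompact (g ⁻¹' closedBall u R))
    (u : EuclideanSpace ℝ (Fin m)) :
    ∃ Φ : Diffeomorph I I N N ∞, ∀ y, g (Φ y) = g y + u := by
  obtain ⟨T, S, hT, hS, hST, hTS, -, hgT⟩ :=
    exists_contMDiff_trivialisation_of_surjective_mfderiv hg hsurj hK
  refine ⟨{ toFun := fun y => T (u, y)
            invFun := fun y => S (u, y)
            left_inv := fun y => hST u y
            right_inv := fun y => hTS u y
            contMDiff_toFun := hT.comp (contMDiff_const.prodMk contMDiff_id)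
            contMDiff_invFun := hS.comp (contMDiff_const.prodMk contMDiff_id) }, fun y => hgT u y⟩

/-- **All fibres of a proper submersion onto `ℝᵐ` are diffeomorphic to the central fibre through an
ambient diffeomorphism** (Kodaira (2005), Thm. 2.3: "`M_t` is diffeomorphic to `M_s` for any
`t, s ∈ B`", base `ℝᵐ`): for every `u` there is a diffeomorphism `Φ` of `N` with
`Φ(g⁻¹(0)) = g⁻¹(u)`. [cite: Kodaira2005, §2.3 Thm. 2.3] [cite: BrockerJanichIDT1982, (8.12)] -/
theorem exists_diffeomorph_image_fibre_eq
    (hg : ContMDiff I 𝓘(ℝ, EuclideanSpace ℝ (Fin m)) ∞ g)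
    (hsurj : ∀ x, Surjective (mfderiv I 𝓘(ℝ, EuclideanSpace ℝ (Fin m)) g x))
    (hK : ∀ (u : EuclideanSpace ℝ (Fin m)) (R : ℝ), IsCompact (g ⁻¹' closedBall u R))
    (u : EuclideanSpace ℝ (Fin m)) :
    ∃ Φ : Diffeomorph I I N N ∞, Φ '' (g ⁻¹' {0}) = g ⁻¹' {u} := by
  obtain ⟨Φ, hΦ⟩ := exists_diffeomorph_apply_eq_add hg hsurj hK u
  refine ⟨Φ, ?_⟩
  have h := image_preimage_singleton_eq_of_apply_eq_add (Φ := Φ.toEquiv) hΦ 0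
  rw [zero_add] at h
  exact h

end Core

end Literature.Geometry.Manifold

end
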